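import Summits.QuantumFields.QCD.Theorems.ExtinctionBuildsQCD.Negative.WithoutTightCollapse
import Literature.Barriers.QuantumFields.WilsonDeterminantSign
import Literature.MathematicalPhysics.QuantumLattice.WilsonDiracRangeOne
import Literature.MathematicalPhysics.QuantumLattice.MobilityGap
import Literature.MathematicalPhysics.QuantumFieldTheory.QCDPhaseQuenched
import Mathlib.Analysis.Matrix.HermitianFunctionalCalculus
import Mathlib.Data.Real.Sign

/-!
# Stub `stub_aizenmanGrafPointwise` of line `weyl-window` (crux `SpectralDefectExtinction.ExtinctionBuildsQCD`,
# item stmt-QuantumFields-8968) — the Aizenman–Graf representation of `sgn(H_W)`, configuration-wise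

Part 2/4 of the composed stub `stub_fermiProjectorScreening` (the Aizenman–Graf step of line `weyl-window`: band
screening ⇒ Fermi-projector screening; lead seat c2, cycle 2).  For EVERY `SU(3)` gauge field `U` on `(ℤ/T)⁴`, every
bare mass `|m₀| ≤ 1` and all sites `x, y`, the colour–spin block of the sign matrix of the Hermitian Wilson–Dirac
operator `H_W = Γ₅ D_W(U, m₀, 1)` obeys
`π · Σ_{p,q} ‖sgn(H_W)((x,p),(y,q))‖ ≤ Σ_{p,q} ∫_{0<η≤18} (‖G(η)((x,p),(y,q))‖ + ‖G(η)((y,q),(x,p))‖) dη + 576 · 2^{−‖x−y‖₁}`,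
`G(η) = (H_W − iη)⁻¹`, in `ℝ≥0∞` currency (the η-integrals may be infinite on the null set where `H_W` has a kernel
through `(x, ·), (y, ·)`; no invertibility is assumed).  Inputs, taken as hypotheses `h2a`, `h2b` (both LANDED:
`stub_signKernelResolventBound` p108317, `stub_arctanKernelLocality` p108428): the abstract sign-kernel/resolvent
bound `‖π sgn(H)(a,b) − 2 atn_Y(H)(a,b)‖ ≤ ∫_{(0,Y]} (‖G(η)(a,b)‖ + ‖G(η)(b,a)‖) dη` and the power-series locality of
`arctan(H/2b)` for a range-one Hermitian `H` with spectrum in `[−b, b]`; here `b = 9` (spectral bound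
`‖H_W‖ ≤ |m₀ + 4| + 4 ≤ 9`, `abs_eigenvalue_hW_le_nine`) and `H_W` is range one in the taxi distance of the sites
(`WilsonDiracRangeOne`).  References (prose): Aizenman–Graf, J. Phys. A 31 (1998) 6783, §2; Aizenman–Warzel, GSM 168, Ch. 13.
-/

noncomputable section

namespace Summit.QuantumFields.QCD.Cruxes.ExtinctionBuildsQCD.WeylWindow

open scoped BigOperators ENNReal ComplexConjugate
open MeasureTheory Matrix Finset
open Literature.MathematicalPhysics.QuantumLattice Literature.MathematicalPhysics.QuantumFieldTheory
  Literature.Probability.LatticeModels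

section Pointwise

variable {T : ℕ} [NeZero T]

/-- Counting the colour–spin block: `Σ_{p,q : Fin 3 × Fin 4} c = 144 c` in `ℝ≥0∞`. -/
theorem sum_sum_const_ennreal (c : ℝ≥0∞) :
    ∑ _p : Fin 3 × Fin 4, ∑ _q : Fin 3 × Fin 4, c = 144 * c := by
  simp only [Finset.sum_const, Finset.card_univ, Fintype.card_prod, Fintype.card_fin, nsmul_eq_mul]
  push_cast
  ring


/-- `144 · ofReal r = ofReal (144 r)`. -/
theorem ofReal_mul_144 (r : ℝ) : (144 : ℝ≥0∞) * ENNReal.ofReal r = ENNReal.ofReal (144 * r) := by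
  have h144 : (144 : ℝ≥0∞) = ENNReal.ofReal 144 := by
    rw [show (144 : ℝ) = ((144 : ℕ) : ℝ) by norm_num, ENNReal.ofReal_natCast]
    norm_num
  rw [h144, ← ENNReal.ofReal_mul (by norm_num)]


/-- **Range one**: a non-zero entry of `H_W(U) = Γ₅ D_W(U, m₀, 1)` joins sites at taxi distance `≤ 1`
(`WilsonDiracRangeOne`; the chirality signs do not change the zero pattern). -/
theorem torusTaxiDist_le_one_of_hW_ne_zero (U : GaugeConfig 4 T SU3) (m₀ : ℝ)
    (p q : TorusSite 4 T × Fin 3 × Fin 4)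
    (h : (spinorLift gammaFive * wilsonDirac (fundamentalRep (Fin 3)) U m₀ 1 :
      Matrix (TorusSite 4 T × Fin 3 × Fin 4) (TorusSite 4 T × Fin 3 × Fin 4) ℂ) p q ≠ 0) :
    torusTaxiDist p.1 q.1 ≤ 1 := by
  refine torusTaxiDist_le_one_of_wilsonDirac_ne_zero (fundamentalRep (Fin 3))
    (fun g => fundamentalRep_mem_unitaryGroup g) U m₀ p q fun hD => h ?_
  rw [spinorLift_gammaFive_eq_diagonal, diagonal_mul, hD, mul_zero]

open scoped Matrix.Norms.L2Operator in
/-- **Spectral bound at bounded mass**: for `|m₀| ≤ 1` every eigenvalue of `H_W(U, m₀)` has modulus `≤ 9`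
(`‖Γ₅ v‖ = ‖v‖` entrywise and `‖D_W‖ ≤ |m₀ + 4| + 4 ≤ 9`). -/
theorem abs_eigenvalue_hW_le_nine (U : GaugeConfig 4 T SU3) (m₀ : ℝ) (hm₀ : |m₀| ≤ 1)
    (hM : (spinorLift gammaFive * wilsonDirac (fundamentalRep (Fin 3)) U m₀ 1 :
      Matrix (TorusSite 4 T × Fin 3 × Fin 4) (TorusSite 4 T × Fin 3 × Fin 4) ℂ).IsHermitian)
    (i : TorusSite 4 T × Fin 3 × Fin 4) : |hM.eigenvalues i| ≤ 9 := by
  have hb : |m₀ + 4| + 4 ≤ 9 := by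
    have := abs_le.1 hm₀
    have : |m₀ + 4| ≤ 5 := abs_le.2 ⟨by linarith, by linarith⟩
    linarith
  set H : Matrix (TorusSite 4 T × Fin 3 × Fin 4) (TorusSite 4 T × Fin 3 × Fin 4) ℂ :=
    spinorLift gammaFive * wilsonDirac (fundamentalRep (Fin 3)) U m₀ 1 with hH
  set D := wilsonDirac (fundamentalRep (Fin 3)) U m₀ 1 with hD
  set z : ℂ := ((hM.eigenvalues i : ℝ) : ℂ) with hz
  have hroot : z ∈ H.charpoly.roots := by
    rw [hM.roots_charpoly_eq_eigenvalues, Multiset.mem_map]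
    exact ⟨i, Finset.mem_univ_val i, rfl⟩
  have hspec : z ∈ spectrum ℂ H :=
    Matrix.mem_spectrum_iff_isRoot_charpoly.2 ((Polynomial.mem_roots H.charpoly_monic.ne_zero).1 hroot)
  rw [spectrum.mem_iff, Matrix.isUnit_iff_isUnit_det, isUnit_iff_ne_zero, not_not] at hspec
  obtain ⟨v, hv, hv0⟩ := Matrix.exists_mulVec_eq_zero_iff.2 hspec
  rw [Algebra.algebraMap_eq_smul_one, Matrix.sub_mulVec, Matrix.smul_mulVec, Matrix.one_mulVec,
    sub_eq_zero] at hv0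
  have hHv : ∑ j, ‖(H *ᵥ v) j‖ ^ 2 = ∑ j, ‖(D *ᵥ v) j‖ ^ 2 := by
    refine Finset.sum_congr rfl fun j _ => ?_
    rw [hH, ← Matrix.mulVec_mulVec, spinorLift_gammaFive_eq_diagonal, mulVec_diagonal, norm_mul]
    have h1 : ‖(![1, 1, -1, -1] : Fin 4 → ℂ) j.2.2‖ = 1 := by
      rcases j with ⟨x, a, α⟩
      fin_cases α <;> simp
    rw [h1, one_mul]
  have hDv : ∑ j, ‖(D *ᵥ v) j‖ ^ 2 ≤ (9 : ℝ) ^ 2 * ∑ j, ‖v j‖ ^ 2 := by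
    refine (sum_norm_sq_mulVec_le D v).trans ?_
    have hn : ‖D‖ ≤ 9 :=
      (l2_opNorm_wilsonDirac_le _ (fun g => fundamentalRep_mem_unitaryGroup g) U m₀).trans hb
    exact mul_le_mul_of_nonneg_right (pow_le_pow_left₀ (norm_nonneg _) hn 2)
      (Finset.sum_nonneg fun j _ => by positivity)
  have hzv : ∑ j, ‖(H *ᵥ v) j‖ ^ 2 = ‖z‖ ^ 2 * ∑ j, ‖v j‖ ^ 2 := by
    rw [← hv0, Finset.mul_sum]
    exact Finset.sum_congr rfl fun j _ => by rw [Pi.smul_apply, smul_eq_mul, norm_mul, mul_pow]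
  have hpos := Summit.QuantumFields.QCD.Theorems.ExtinctionBuildsQCD.Negative.sum_norm_sq_pos hv
  have hsq : ‖z‖ ^ 2 ≤ (9 : ℝ) ^ 2 := le_of_mul_le_mul_right (by rw [← hzv, hHv]; exact hDv) hpos
  have hzabs : ‖z‖ = |hM.eigenvalues i| := by rw [hz, Complex.norm_real, Real.norm_eq_abs]
  rw [← hzabs]
  exact (sq_le_sq₀ (norm_nonneg _) (by norm_num)).1 hsq


/-- **Stub `stub_aizenmanGrafPointwise` — the Aizenman–Graf representation of `sgn(H_W)`, configuration-wise.**
GIVEN the abstract sign-kernel/resolvent bound (`h2a`, landed `stub_signKernelResolventBound`) and the arctan-kernel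
locality (`h2b`, landed `stub_arctanKernelLocality`): for every torus, every `SU(3)` field `U`, every `|m₀| ≤ 1` and all
sites `x, y`, `π Σ_{p,q}‖sgn(Γ₅D_W(U,m₀,1))((x,p),(y,q))‖ ≤ Σ_{p,q}∫⁻_{(0,18]}(‖G(η)((x,p),(y,q))‖ₑ + ‖G(η)((y,q),(x,p))‖ₑ)dη
+ 576·2^{−‖x−y‖₁}` with `G(η) = (Γ₅D_W(U,m₀,1) − iη)⁻¹`. -/
theorem stub_aizenmanGrafPointwise :
    (∀ (ι : Type) [Fintype ι] [DecidableEq ι] (H : Matrix ι ι ℂ), H.IsHermitian → ∀ (Y : ℝ), 0 < Y →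
      ∀ x y : ι,
        (∀ η : ℝ, η ≠ 0 → ‖(H - ((η : ℂ) * Complex.I) • (1 : Matrix ι ι ℂ))⁻¹ x y‖ ≤ |η|⁻¹) ∧
        ‖(Real.pi : ℂ) * (cfc Real.sign H) x y -
            2 * (cfc (fun t : ℝ => Real.arctan (t / Y)) H) x y‖ₑ ≤
          ∫⁻ η in Set.Ioc (0 : ℝ) Y, (‖(H - ((η : ℂ) * Complex.I) • (1 : Matrix ι ι ℂ))⁻¹ x y‖ₑ +
            ‖(H - ((η : ℂ) * Complex.I) • (1 : Matrix ι ι ℂ))⁻¹ y x‖ₑ)) →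
    (∀ (ι : Type) [Fintype ι] [DecidableEq ι] (d : ι → ι → ℕ), (∀ p, d p p = 0) → (∀ p q, d p q = d q p) →
      (∀ p q r, d p r ≤ d p q + d q r) →
      ∀ (H : Matrix ι ι ℂ) (hH : H.IsHermitian) (b : ℝ), 0 < b → (∀ i, |hH.eigenvalues i| ≤ b) →
      (∀ p q, 1 < d p q → H p q = 0) →
      ∀ x y : ι, ‖(cfc (fun t : ℝ => Real.arctan (t / (2 * b))) H) x y‖ ≤ 2 * (1 / 2) ^ d x y) →
    ∀ (T : ℕ) [NeZero T] (U : GaugeConfig 4 T SU3) (m₀ : ℝ), |m₀| ≤ 1 → ∀ (x y : TorusSite 4 T),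
      ENNReal.ofReal (Real.pi * ∑ p : Fin 3 × Fin 4, ∑ q : Fin 3 × Fin 4,
        ‖(cfc Real.sign (spinorLift gammaFive * wilsonDirac (fundamentalRep (Fin 3)) U m₀ 1) :
          Matrix (TorusSite 4 T × Fin 3 × Fin 4) (TorusSite 4 T × Fin 3 × Fin 4) ℂ) (x, p) (y, q)‖) ≤
      (∑ p : Fin 3 × Fin 4, ∑ q : Fin 3 × Fin 4, ∫⁻ η in Set.Ioc (0 : ℝ) (2 * 9),
        (‖((spinorLift gammaFive * wilsonDirac (fundamentalRep (Fin 3)) U m₀ 1 - ((η : ℂ) * Complex.I) • 1)⁻¹ :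
            Matrix (TorusSite 4 T × Fin 3 × Fin 4) (TorusSite 4 T × Fin 3 × Fin 4) ℂ) (x, p) (y, q)‖ₑ +
         ‖((spinorLift gammaFive * wilsonDirac (fundamentalRep (Fin 3)) U m₀ 1 - ((η : ℂ) * Complex.I) • 1)⁻¹ :
            Matrix (TorusSite 4 T × Fin 3 × Fin 4) (TorusSite 4 T × Fin 3 × Fin 4) ℂ) (y, q) (x, p)‖ₑ)) +
      ENNReal.ofReal (576 * (1 / 2) ^ torusTaxiDist x y)  := by
  intro h2a h2b T _ U m₀ hm₀ x y
  obtain ⟨Hw, hHw⟩ : ∃ Hw : Matrix (TorusSite 4 T × Fin 3 × Fin 4) (TorusSite 4 T × Fin 3 × Fin 4) ℂ,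
      Hw = spinorLift gammaFive * wilsonDirac (fundamentalRep (Fin 3)) U m₀ 1 := ⟨_, rfl⟩
  obtain ⟨G, hG⟩ : ∃ G : ℝ → Matrix (TorusSite 4 T × Fin 3 × Fin 4) (TorusSite 4 T × Fin 3 × Fin 4) ℂ,
      ∀ η, G η = (Hw - ((η : ℂ) * Complex.I) •
        (1 : Matrix (TorusSite 4 T × Fin 3 × Fin 4) (TorusSite 4 T × Fin 3 × Fin 4) ℂ))⁻¹ := ⟨_, fun _ => rfl⟩
  simp only [← hHw, ← hG]
  set d : ℕ := torusTaxiDist x y with hd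
  have hHerm : Hw.IsHermitian := by
    rw [hHw]
    exact Literature.Barriers.QuantumFields.WilsonDeterminant.isHermitian_hermitianWilsonDirac _
      (fun g => fundamentalRep_mem_unitaryGroup g) U m₀ 1
  -- (2a) specialised at `Y = 18`
  have h2aU : ∀ p q : Fin 3 × Fin 4,
      ‖(Real.pi : ℂ) * (cfc Real.sign Hw) (x, p) (y, q) -
          2 * (cfc (fun t : ℝ => Real.arctan (t / (2 * 9))) Hw) (x, p) (y, q)‖ₑ ≤
        ∫⁻ η in Set.Ioc (0 : ℝ) (2 * 9), (‖G η (x, p) (y, q)‖ₑ + ‖G η (y, q) (x, p)‖ₑ) := by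
    intro p q
    have h := (h2a (TorusSite 4 T × Fin 3 × Fin 4) Hw hHerm (2 * 9) (by norm_num) (x, p) (y, q)).2
    simpa only [← hG] using h
  -- (2b) specialised: `H_W` is range one in the taxi distance of the sites, spectrum in `[−9, 9]`
  have h2bU : ∀ p q : Fin 3 × Fin 4,
      ‖(cfc (fun t : ℝ => Real.arctan (t / (2 * 9))) Hw) (x, p) (y, q)‖ ≤ 2 * (1 / 2) ^ d := by
    intro p q
    refine h2b (TorusSite 4 T × Fin 3 × Fin 4) (fun a c => torusTaxiDist a.1 c.1) (fun a => torusTaxiDist_self a.1)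
      (fun a c => torusTaxiDist_comm a.1 c.1)
      (fun a c e => torusDistOne_triangle (Ls := fun _ : Fin 4 => T) a.1 c.1 e.1)
      Hw hHerm 9 (by norm_num) ?_ ?_ (x, p) (y, q)
    · intro i
      have hM' : (spinorLift gammaFive * wilsonDirac (fundamentalRep (Fin 3)) U m₀ 1 :
          Matrix (TorusSite 4 T × Fin 3 × Fin 4) (TorusSite 4 T × Fin 3 × Fin 4) ℂ).IsHermitian := by
        rw [← hHw]; exact hHerm
      have h9 := abs_eigenvalue_hW_le_nine U m₀ hm₀ hM' i
      have heq : hM'.eigenvalues = hHerm.eigenvalues := by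
        congr 1
        exact hHw.symm
      simpa only [heq] using h9
    · intro a c hac
      by_contra hne
      rw [hHw] at hne
      exact absurd (torusTaxiDist_le_one_of_hW_ne_zero U m₀ a c hne) (not_le.2 hac)
  -- entrywise
  have hentry : ∀ p q : Fin 3 × Fin 4,
      ENNReal.ofReal (Real.pi * ‖(cfc Real.sign Hw) (x, p) (y, q)‖) ≤
        (∫⁻ η in Set.Ioc (0 : ℝ) (2 * 9), (‖G η (x, p) (y, q)‖ₑ + ‖G η (y, q) (x, p)‖ₑ)) +
          ENNReal.ofReal (4 * (1 / 2) ^ d) := by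
    intro p q
    set z : ℂ := (cfc Real.sign Hw) (x, p) (y, q)
    set w : ℂ := (cfc (fun t : ℝ => Real.arctan (t / (2 * 9))) Hw) (x, p) (y, q)
    have hsplit : (Real.pi : ℂ) * z = ((Real.pi : ℂ) * z - 2 * w) + 2 * w := by ring
    have hπz : ENNReal.ofReal (Real.pi * ‖z‖) = ‖(Real.pi : ℂ) * z‖ₑ := by
      rw [← ofReal_norm, norm_mul, Complex.norm_real, Real.norm_of_nonneg Real.pi_pos.le]
    have hw : ‖w‖ ≤ 2 * (1 / 2) ^ d := h2bU p q
    rw [hπz, hsplit]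
    refine (enorm_add_le _ _).trans (add_le_add (h2aU p q) ?_)
    rw [← ofReal_norm, norm_mul, Complex.norm_two]
    exact ENNReal.ofReal_le_ofReal (by linarith)
  -- sum over the colour–spin block
  obtain ⟨F, hF⟩ : ∃ F : Fin 3 × Fin 4 → Fin 3 × Fin 4 → ℝ,
      ∀ p q, F p q = ‖(cfc Real.sign Hw) (x, p) (y, q)‖ := ⟨_, fun _ _ => rfl⟩
  simp only [← hF] at hentry ⊢
  have hsum : ENNReal.ofReal (Real.pi * ∑ p : Fin 3 × Fin 4, ∑ q : Fin 3 × Fin 4, F p q) =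
      ∑ p : Fin 3 × Fin 4, ∑ q : Fin 3 × Fin 4, ENNReal.ofReal (Real.pi * F p q) := by
    have hFnn : ∀ p q, 0 ≤ F p q := fun p q => by rw [hF]; exact norm_nonneg _
    rw [Finset.mul_sum, ENNReal.ofReal_sum_of_nonneg (fun p _ => mul_nonneg Real.pi_pos.le
      (Finset.sum_nonneg fun q _ => hFnn p q))]
    refine Finset.sum_congr rfl fun p _ => ?_
    rw [Finset.mul_sum, ENNReal.ofReal_sum_of_nonneg (fun q _ => mul_nonneg Real.pi_pos.le (hFnn p q))]
  rw [hsum]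
  calc ∑ p : Fin 3 × Fin 4, ∑ q : Fin 3 × Fin 4, ENNReal.ofReal (Real.pi * F p q)
      ≤ ∑ p : Fin 3 × Fin 4, ∑ q : Fin 3 × Fin 4,
          ((∫⁻ η in Set.Ioc (0 : ℝ) (2 * 9), (‖G η (x, p) (y, q)‖ₑ + ‖G η (y, q) (x, p)‖ₑ)) +
            ENNReal.ofReal (4 * (1 / 2) ^ d)) :=
        Finset.sum_le_sum fun p _ => Finset.sum_le_sum fun q _ => hentry p q
    _ = (∑ p : Fin 3 × Fin 4, ∑ q : Fin 3 × Fin 4,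
          ∫⁻ η in Set.Ioc (0 : ℝ) (2 * 9), (‖G η (x, p) (y, q)‖ₑ + ‖G η (y, q) (x, p)‖ₑ)) +
          ENNReal.ofReal (576 * (1 / 2) ^ d) := by
        simp only [Finset.sum_add_distrib]
        congr 1
        rw [sum_sum_const_ennreal, ofReal_mul_144]
        congr 1
        ring

end Pointwise

end Summit.QuantumFields.QCD.Cruxes.ExtinctionBuildsQCD.WeylWindow

end
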